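import Mathlib
import HarnessLib
import Summits.NavierStokesRegularity.FluidComputer.TriggeredTransferCascadeSolution
import Summits.NavierStokesRegularity.FluidComputer.PalasekTowerForceBudget
import Summits.NavierStokesRegularity.FluidComputer.PalasekTowerClayBridgeUniquenessHolds

/-!
# CASCADE GLUING v2, concluded: a cascade of triggered transfers (level-`0` state Clay, hand-over
# states merely `H¹`) yields an exact forced blow-up and Fefferman's (C) — with NO named fact
# (door N1-FC, analysis half v2, file 5/5)

Cell `ns-blowup`, seat `ns-blowup-fc-prover-1` (g5; D-0074 GROUP C «bridge support», door N1-FC).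
This is `TriggeredTransferWitness.lean` (this seat, g2) re-run over the ALPHABET-FREE type
`TriggerScheme.Cascade ν` (`TriggeredTransferCascade.lean`; chain `…CascadeClock/Pieces/Solution`):
the limit fields on `[0, T*)`, the Clay force, the floors and the blow-up use only the glued solution,
the clock and the level-`0` datum, so the g2 text carries over with `ρ : 𝒮.Cascade ν` (explicit
binder in every signature; theorems about a different type than `Run`'s); the ONE changed line is the
datum clause, now read off `Cascade.decay_zero`. LABEL: E–C; the ANALYSIS HALF of door N1-FC, v2.
WHAT THIS IS NOT: not Navier–Stokes evidence — an IMPLICATION from the existence of a cascade, a type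
the tree inhabits only under OPEN door predicates (`TriggerScheme.Transfers`: v1, Clay alphabet;
`TriggerSchemeH1.Transfers`: v2, `H¹` working alphabet — `TriggeredTransferH1.lean`), asserted
nowhere; no scheme instance is claimed; MODEL words (PREREG-FC-TRIG-1 and -2) never enter.

Main results (`ν > 0`):

* `Cascade.limitVel/limitPrs`, `Cascade.limit_classical` (exact classical solution of the system forced
  by the summed force on `[0, T*)`), `Cascade.limitVel_zero` (datum `w 0`), `Cascade.limit_energy`,
  `Cascade.exists_speed_ge` / `Cascade.limit_unbounded` (speed `≥ c U_n → ∞` in the blow-up ball),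
  `Cascade.force_clay` (Clay force, silent from `T*` on);
* `Cascade.toWitness : BreakdownWitness ν`;
* **`nonempty_breakdownWitness_of_cascade : 0 < ν → Nonempty (𝒮.Cascade ν) → Nonempty (BreakdownWitness ν)`**;
* **`navierStokesBreakdownR3_of_cascade : 0 < ν → Nonempty (𝒮.Cascade ν) → NavierStokesBreakdownR3`**
  — ZERO named facts: the competing global smooth solution is excluded by Tao's Cor. 11.4 WITH force,
  now the tree THEOREM `tao_unconditional_uniqueness_velocity_forced_holds`
  (`PalasekTowerClayBridgeUniquenessHolds.lean`).

So ANY door that produces a cascade — whatever its alphabet — closes on (C); the v1 closer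
`navierStokesBreakdownR3_of_transfers` is the case `Run.toCascade`
(`navierStokesBreakdownR3_of_transfers'`, below, now without its W14 hypothesis).

References: T. Tao, J. Amer. Math. Soc. 29 (2016) 601–674, §1.3 [cite: Tao2016AveragedNS, §1.3];
C. L. Fefferman, Clay problem description, (C) [cite: FeffermanClay2006, (C)]; T. Tao, Anal. PDE 6
(2013), Cor. 11.4 [cite: Tao2011, Cor. 11.4]; J. Leray, Acta Math. 63 (1934) §20 [cite: Leray1934, §20].
0 sorry; axioms ⊆ {propext, Classical.choice, Quot.sound}.
-/

noncomputable section

namespace Summit.NavierStokesRegularity.FluidComputer.TriggeredTransfer.TriggerScheme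

open Set Filter Function MeasureTheory
open scoped Topology ENNReal ContDiff
open Literature.Analysis.FluidPDE
open Literature.Analysis.FluidPDE.FluidComputer (E3 Vel)
open Summit.NavierStokesRegularity.FluidComputer.PalasekTowerClayBridge (BreakdownWitness
  navierStokesBreakdownR3_of_witness tao_unconditional_uniqueness_velocity_forced_holds)

namespace Cascade

variable {𝒮 : TriggerScheme} {ν : ℝ}

/-! ## The limit fields on `[0, T*)` -/

/-- The level used at time `t`: the first level whose window passes `t` (for `t < T*`; `0` after). [folklore] -/
def idx (ρ : 𝒮.Cascade ν) (hν : 0 < ν) (t : ℝ) : ℕ := if h : t < ρ.Tstar then ρ.level hν h else 0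

/-- **The velocity of the cascade** on `[0, T*)`: the glued velocity through level `idx t`, at `t`. [folklore] -/
def limitVel (ρ : 𝒮.Cascade ν) (hν : 0 < ν) : ℝ → Vel := fun t => ρ.gvel (ρ.idx hν t) t

/-- **The pressure of the cascade** on `[0, T*)`. [folklore] -/
def limitPrs (ρ : 𝒮.Cascade ν) (hν : 0 < ν) : ℝ → E3 → ℝ := fun t => ρ.gprs (ρ.idx hν t) t

/-- Before `stop n` the limit velocity IS the velocity glued through level `n` (stability). [folklore] -/
theorem limitVel_eq_gvel (ρ : 𝒮.Cascade ν) (hν : 0 < ν) {n : ℕ} {t : ℝ} (ht : t < ρ.stop n) :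
    ρ.limitVel hν t = ρ.gvel n t := by
  have hT : t < ρ.Tstar := ht.trans (ρ.stop_lt_Tstar hν n)
  have hidx : ρ.idx hν t = ρ.level hν hT := by rw [idx, dif_pos hT]
  have hle : ρ.level hν hT ≤ n := Nat.find_min' _ ht
  rw [limitVel, hidx]
  exact (ρ.gvel_apply_of_lt_stop hle (ρ.lt_stop_level hν hT)).symm

/-- Before `stop n` the limit pressure IS the pressure glued through level `n`. [folklore] -/
theorem limitPrs_eq_gprs (ρ : 𝒮.Cascade ν) (hν : 0 < ν) {n : ℕ} {t : ℝ} (ht : t < ρ.stop n) :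
    ρ.limitPrs hν t = ρ.gprs n t := by
  have hT : t < ρ.Tstar := ht.trans (ρ.stop_lt_Tstar hν n)
  have hidx : ρ.idx hν t = ρ.level hν hT := by rw [idx, dif_pos hT]
  have hle : ρ.level hν hT ≤ n := Nat.find_min' _ ht
  rw [limitPrs, hidx]
  exact (ρ.gprs_apply_of_lt_stop hle (ρ.lt_stop_level hν hT)).symm

/-- The time sets: `[0, T*) ∩ (-∞, stop n) = [0, stop n)`. [folklore] -/
theorem Ico_inter_Iio_stop (ρ : 𝒮.Cascade ν) (hν : 0 < ν) (n : ℕ) : Ico 0 ρ.Tstar ∩ Iio (ρ.stop n) = Ico 0 (ρ.stop n) := by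
  ext τ
  simp only [mem_inter_iff, mem_Ico, mem_Iio]
  exact ⟨fun h => ⟨h.1.1, h.2⟩, fun h => ⟨⟨h.1, h.2.trans (ρ.stop_lt_Tstar hν n)⟩, h.2⟩⟩

/-- **The cascade is an exact classical solution on `[0, T*)`** of the system forced by the summed
force: locally (before `stop n`) it is the glued solution through level `n`; joint smoothness is local
and the one-sided time derivative within `[0, T*)` agrees with that within `[0, stop n)` near `t`. [cite: Tao2016AveragedNS, §1.3] -/
theorem limit_classical (ρ : 𝒮.Cascade ν) (hν : 0 < ν) :
    IsClassicalNSSolutionOn (Ico 0 ρ.Tstar) ν ρ.force (ρ.limitVel hν) (ρ.limitPrs hν) := by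
  have hP : ∀ n, (Ico 0 ρ.Tstar ×ˢ (univ : Set E3)) ∩ Iio (ρ.stop n) ×ˢ univ =
      Ico 0 (ρ.stop n) ×ˢ univ := fun n => by
    rw [prod_inter_prod, ρ.Ico_inter_Iio_stop hν n, inter_self]
  refine ⟨?_, ?_, ?_, ?_⟩
  · -- smoothness of the velocity: local
    refine contDiffOn_of_locally_contDiffOn fun z hz => ?_
    obtain ⟨t, x⟩ := z
    have ht : t ∈ Ico 0 ρ.Tstar := hz.1
    obtain ⟨n, hn⟩ := ρ.exists_lt_stop hν ht.2
    refine ⟨Iio (ρ.stop n) ×ˢ univ, isOpen_Iio.prod isOpen_univ, ⟨hn, mem_univ _⟩, ?_⟩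
    rw [hP n]
    refine (ρ.gvel_classical hν n).smooth_velocity.congr fun z hz => ?_
    obtain ⟨τ, y⟩ := z
    have hτ : τ < ρ.stop n := hz.1.2
    simp only [uncurry_apply_pair, ρ.limitVel_eq_gvel hν hτ]
  · -- smoothness of the pressure: local
    refine contDiffOn_of_locally_contDiffOn fun z hz => ?_
    obtain ⟨t, x⟩ := z
    have ht : t ∈ Ico 0 ρ.Tstar := hz.1
    obtain ⟨n, hn⟩ := ρ.exists_lt_stop hν ht.2
    refine ⟨Iio (ρ.stop n) ×ˢ univ, isOpen_Iio.prod isOpen_univ, ⟨hn, mem_univ _⟩, ?_⟩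
    rw [hP n]
    refine (ρ.gvel_classical hν n).smooth_pressure.congr fun z hz => ?_
    obtain ⟨τ, y⟩ := z
    have hτ : τ < ρ.stop n := hz.1.2
    simp only [uncurry_apply_pair, ρ.limitPrs_eq_gprs hν hτ]
  · -- the momentum equation
    intro t ht x
    obtain ⟨n, hn⟩ := ρ.exists_lt_stop hν ht.2
    have hev : (fun τ => ρ.limitVel hν τ x) =ᶠ[𝓝 t] fun τ => ρ.gvel n τ x := by
      filter_upwards [Iio_mem_nhds hn] with τ hτ
      rw [ρ.limitVel_eq_gvel hν hτ]
    have hD : timeDerivWithin (Ico 0 ρ.Tstar) (ρ.limitVel hν) t x =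
        timeDerivWithin (Ico 0 (ρ.stop n)) (ρ.gvel n) t x := by
      simp only [timeDerivWithin_apply]
      rw [(hev.filter_mono nhdsWithin_le_nhds).derivWithin_eq (by rw [ρ.limitVel_eq_gvel hν hn]),
        ← ρ.Ico_inter_Iio_stop hν n, derivWithin_inter (Iio_mem_nhds hn)]
    rw [hD, ρ.limitVel_eq_gvel hν hn, ρ.limitPrs_eq_gprs hν hn]
    exact (ρ.gvel_classical hν n).momentum t ⟨ht.1, hn⟩ x
  · -- incompressibility
    intro t ht
    obtain ⟨n, hn⟩ := ρ.exists_lt_stop hν ht.2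
    rw [ρ.limitVel_eq_gvel hν hn]
    exact (ρ.gvel_classical hν n).divFree t ⟨ht.1, hn⟩

/-- **The datum of the cascade is the ignition state `w 0`** (unit zoom about the origin). [folklore] -/
theorem limitVel_zero (ρ : 𝒮.Cascade ν) (hν : 0 < ν) : ρ.limitVel hν 0 = ρ.w 0 := by
  rw [ρ.limitVel_eq_gvel hν (ρ.stop_pos 0), gvel_zero, ← ρ.start_zero, ρ.vel_start]
  funext x
  simp [zoom_apply, 𝒮.mag_zero, ρ.centre_zero]

/-- **Finite energy on closed slabs before `T*`**. [folklore] -/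
theorem limit_energy (ρ : 𝒮.Cascade ν) (hν : 0 < ν) {T' : ℝ} (hT' : T' < ρ.Tstar) :
    ∃ C : ℝ≥0∞, C < ⊤ ∧ ∀ t ∈ Icc 0 T', ∫⁻ x, ‖ρ.limitVel hν t x‖ₑ ^ 2 ≤ C := by
  obtain ⟨n, hn⟩ := ρ.exists_lt_stop hν hT'
  obtain ⟨C, hC, hb⟩ := ρ.gvel_energy n
  refine ⟨C, hC, fun t ht => ?_⟩
  rw [ρ.limitVel_eq_gvel hν (ht.2.trans_lt hn)]
  exact hb t ⟨ht.1, ht.2.trans_lt hn⟩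

/-- **The velocity floors survive the zoom**: at the start time of level `n` the cascade has speed
at least `c · U_n · λⁿ ≥ c · U_n` somewhere in the blow-up ball `B̄(0, ballRadius)`. [folklore] -/
theorem exists_speed_ge (ρ : 𝒮.Cascade ν) (hν : 0 < ν) (n : ℕ) :
    ∃ x : E3, ‖x‖ ≤ 𝒮.ballRadius ∧ 𝒮.c * ρ.U n ≤ ‖ρ.limitVel hν (ρ.start n) x‖ := by
  obtain ⟨y, hyR, hfloor⟩ := ρ.exists_floor n
  refine ⟨ρ.centre n + (𝒮.mag n)⁻¹ • y, ρ.norm_centre_add_le n hyR, ?_⟩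
  rw [ρ.limitVel_eq_gvel hν (ρ.start_lt_stop n), ρ.gvel_apply_start, ρ.vel_start, zoom_apply,
    add_sub_cancel_left, smul_smul, mul_inv_cancel₀ (𝒮.mag_pos n).ne', one_smul, norm_smul,
    Real.norm_of_nonneg (𝒮.mag_pos n).le]
  exact hfloor.trans (le_mul_of_one_le_left (norm_nonneg _) (𝒮.one_le_mag n))

/-- **Local unboundedness**: the cascade's speed exceeds every bound at some start time, in the
blow-up ball (the level Reynolds numbers `U_n → ∞`). [folklore] -/
theorem limit_unbounded (ρ : 𝒮.Cascade ν) (hν : 0 < ν) (M : ℝ) :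
    ∃ t ∈ Ico 0 ρ.Tstar, ∃ x : E3, ‖x‖ ≤ 𝒮.ballRadius ∧ M < ‖ρ.limitVel hν t x‖ := by
  obtain ⟨n, hn⟩ := (ρ.tendsto_U.eventually (eventually_ge_atTop (M / 𝒮.c + 1))).exists
  obtain ⟨x, hx, hspeed⟩ := ρ.exists_speed_ge hν n
  refine ⟨ρ.start n, ⟨ρ.start_nonneg n, ρ.start_lt_Tstar hν n⟩, x, hx, lt_of_lt_of_le ?_ hspeed⟩
  have hc := 𝒮.c_pos
  have h1 : M / 𝒮.c < ρ.U n := by linarith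
  calc M = 𝒮.c * (M / 𝒮.c) := by field_simp
    _ < 𝒮.c * ρ.U n := mul_lt_mul_of_pos_left h1 hc

/-- **The summed force is a Clay-class force, silent from `T*` on**: smooth on the closed half-space
(indeed on all of space–time), with Fefferman's decay (5), and zero for `t ≥ T*` — by
`PalasekTowerForceBudget.clayForce_of_summable_levels` from the summable `C^m` sizes
`A_m λ^{n(3+2m)} ε_n` of the zoomed triggers, all supported in `[0, T*] × B̄(0, ballRadius)`.
[cite: FeffermanClay2006, (C) (5) (6)] -/
theorem force_clay (ρ : 𝒮.Cascade ν) (hν : 0 < ν) :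
    IsSmoothOnHalfSpace ρ.force ∧ HasRapidSpaceTimeDecay ρ.force ∧
      ∀ t, ρ.Tstar ≤ t → ∀ x, ρ.force t x = 0 := by
  have h := PalasekTowerForceBudget.clayForce_of_summable_levels
    (fun n z => ρ.frc n z.1 z.2) ρ.Tstar 𝒮.ballRadius (fun k => ρ.contDiff_frc k)
    (fun k z hz => by
      show ρ.frc k z.1 z.2 = 0
      rw [ρ.frc_eq_zero_of_ge ((ρ.start_lt_Tstar hν (k + 1)).le.trans hz)]
      rfl)
    (fun k z hz => ρ.frc_apply_eq_zero_of_far z.1 hz)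
    (fun m => ⟨_, ρ.summable_frc_bound hν m, fun k z => ρ.norm_iteratedFDeriv_frc_le k m z⟩)
  exact h

/-! ## The witness and the door -/

/-- **A cascade IS an E–C witness** at its viscosity: the cascade `(limitVel, limitPrs, force)`
on `[0, T*)` — exact classical forced Navier–Stokes from the Clay datum `w 0`, Clay-class force smooth
THROUGH `T*`, finite energy on closed slabs before `T*`, speed unbounded in the fixed ball
`B̄(0, R + D λ/(λ-1))` as `t ↑ T*`. [cite: FeffermanClay2006, (C)] -/
def toWitness (ρ : 𝒮.Cascade ν) (hν : 0 < ν) : BreakdownWitness ν where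
  T := ρ.Tstar
  T_pos := ρ.Tstar_pos hν
  u := ρ.limitVel hν
  p := ρ.limitPrs hν
  f := ρ.force
  classical := ρ.limit_classical hν
  datum_decay := by rw [ρ.limitVel_zero hν]; exact ρ.decay_zero
  force_smooth := (ρ.force_clay hν).1
  force_decay := (ρ.force_clay hν).2.1
  energy T' hT' := ρ.limit_energy hν hT'
  radius := 𝒮.ballRadius
  unbounded M := ρ.limit_unbounded hν M

/-- The witness blows up at `T* = Σ_n T_n λ^{-2n}`. [folklore] -/
theorem toWitness_T (ρ : 𝒮.Cascade ν) (hν : 0 < ν) : (ρ.toWitness hν).T = ρ.Tstar := rfl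

/-- The witness's force vanishes identically from the blow-up time on (the cascade is silent after
`T*`; smoothness THROUGH `T*` is `(toWitness hν).force_smooth`). [folklore] -/
theorem toWitness_force_eq_zero (ρ : 𝒮.Cascade ν) (hν : 0 < ν) {t : ℝ} (ht : ρ.Tstar ≤ t) : (ρ.toWitness hν).f t = 0 :=
  funext fun x => (ρ.force_clay hν).2.2 t ht x

end Cascade

/-- **CASCADE GLUING v2 (door N1-FC, analysis half, alphabet-free).** A cascade of triggered
transfers at viscosity `ν > 0` — linked exact forced pieces with the level seeds, a Clay ignition
state, `H¹` hand-over states with speed floors, amplitudes climbing by `(ηλ)^{1/2}` — yields an exact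
forced Navier–Stokes blow-up of Clay class at viscosity `ν`: a `BreakdownWitness ν`. UNCONDITIONAL.
[cite: Tao2016AveragedNS, §1.3] -/
theorem nonempty_breakdownWitness_of_cascade (𝒮 : TriggerScheme) {ν : ℝ} (hν : 0 < ν)
    (h : Nonempty (𝒮.Cascade ν)) : Nonempty (BreakdownWitness ν) := by
  obtain ⟨ρ⟩ := h
  exact ⟨ρ.toWitness hν⟩

/-- **A cascade closes Fefferman's (C), with no named fact.** A cascade of triggered transfers at
one viscosity `ν > 0` gives the breakdown statement `NavierStokesBreakdownR3` (Clay (C), at every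
viscosity, by the tree's `navierStokesBreakdownR3_of_witness`); the competing GLOBAL smooth solution
is excluded by Tao's unconditional uniqueness WITH force, the tree theorem
`tao_unconditional_uniqueness_velocity_forced_holds`. [cite: FeffermanClay2006, (C)] -/
theorem navierStokesBreakdownR3_of_cascade (𝒮 : TriggerScheme) {ν : ℝ} (hν : 0 < ν)
    (h : Nonempty (𝒮.Cascade ν)) :
    Summit.NavierStokesRegularity.NavierStokesRegularity.NavierStokesBreakdownR3 := by
  obtain ⟨W⟩ := 𝒮.nonempty_breakdownWitness_of_cascade hν h
  exact navierStokesBreakdownR3_of_witness hν W tao_unconditional_uniqueness_velocity_forced_holds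

/-- **The v1 door through the cascade, now fact-free**: a transferring (v1) scheme at one viscosity
`ν > 0` gives `NavierStokesBreakdownR3` — `navierStokesBreakdownR3_of_transfers` without its W14
hypothesis (via `Run.toCascade`). [cite: FeffermanClay2006, (C)] -/
theorem navierStokesBreakdownR3_of_transfers' (𝒮 : TriggerScheme) {ν : ℝ} (hν : 0 < ν)
    (hT : 𝒮.Transfers ν) :
    Summit.NavierStokesRegularity.NavierStokesRegularity.NavierStokesBreakdownR3 :=
  𝒮.navierStokesBreakdownR3_of_cascade hν (𝒮.nonempty_cascade_of_transfers hν hT)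

end Summit.NavierStokesRegularity.FluidComputer.TriggeredTransfer.TriggerScheme

end
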